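import Summits.CriticalPhenomena.PercolationContinuityZ3.Theorems.PercNearOneGluingNoHeavyLowerTailFrontierDecRowsEdgeKeyInduction
import Summits.CriticalPhenomena.PercolationContinuityZ3.Theorems.PercNearOneGluingNoHeavyLowerTailFrontierDecRowsClusterMarkovCore
import Summits.CriticalPhenomena.PercolationContinuityZ3.Theorems.PercNearOneGluingNoHeavyLowerTailFrontierDecRowsClusterBHK3Defs
import HarnessLib

/-!
# G⁺ (`ClusterBHK3Pos`) follows from the nonnegativity of the edge KEY form on the cluster-monotone class

Support file (prover prim-ineq-prove-3 gen 10 cycle 1; `--supports stmt-CriticalPhenomena-4575`).  No definitions, no named facts, no sorries,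
no `native_decide`.  CONDITIONAL: the hypothesis `hK` below is written out (it is NOT a tree fact and NOT claimed).

FINDING (memo FINDING-HYBRID-gen10.md §14).  For typed triples `(D, Aᶜ, Bᶜ)` — `D = {S ↮ T}`, `A` an increasing function of the open edge
cluster `C_S` alone, `B` of `C_T` alone — the KEY form of an edge step (`TerminalEdgeInduction.key`, prim-bnk-1 gen 9:
`K_e = 3B₁ − 2B₀ = T(0) + T′(0)` for the Bernstein cubic `T(p) = E₃` along the weight `p = w e`) was found NONNEGATIVE at EVERY edge in all
281 214 exact (case, edge) forms tested (170k connection-literal + 110k general cluster-increasing events, random weighted graphs `n ≤ 6`;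
kit censuses j112929/j112930 for `n ≤ 8`), with `K = 0` attained (≈ 1–5 % of nontrivial forms, typically when `E₃(w[e↦1]) = 0`) and with
`K < E₃(w[e↦0])` in 35 % of forms (so the induction hypothesis is used).  In words: on the typed class Sahi's `E₃` is DELETION-MONOTONE to
first order, `E₃(w) ≥ (1 − w e)·E₃(w[e↦0]) + (w e)²·E₃(w[e↦1])` — the property `DELMONO-E3` that is FALSE for general separation triples
(prim-ineq-prove-2 gen 5, theta-graph witness) and false on abstract cubes `{0,1}⁵` (ttrl cp-sahi2).

THIS FILE: the formal reduction.  By prim-bnk-1's schema `EdgeInduction.sahiE3_nonneg_of_edgeKey` (induction on the number of fractional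
edges; the typed class is a fixed triple of decreasing events, so it is closed under `w ↦ w[e↦0], w[e↦1]`), nonnegativity of the KEY form
for every cluster-monotone `(S,T,A,B)`, every `w` and every `e` — given `E₃ ≥ 0` at both endpoint laws — implies `ClusterBHK3Pos`, hence
(`…ClusterBHK3Defs`, `…TypedBHK3`, `…LiteralDropping`) the open dec rows 12, 15, 27, 30, 36, 44.

* `isLowerSet_compl_of_clusterMono` — complements of cluster-monotone events are decreasing.
* `clusterBHK3Pos_of_key` — THE reduction with the hypothesis written out: KEY `≥ 0` on the typed class ⟹ `ClusterBHK3Pos`.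
* `clusterBHK3Pos_of_clusterBHK3Key` — the same between the two named conjectures: `ClusterBHK3Key → ClusterBHK3Pos`.
-/

noncomputable section

namespace Summit.CriticalPhenomena.PercolationContinuityZ3.Theorems.FrontierDecRows

open MeasureTheory
open Literature.Probability.Percolation Literature.Probability.LatticeModels
open TerminalEdgeInduction

variable {n : ℕ}

/-- The complement of a cluster-monotone event is a down-set. [folklore] -/
theorem isLowerSet_compl_of_clusterMono (S : Set (Fin n)) {A : Set (BondConfig (Fin n))}
    (hA : ∀ ⦃ω ω' : BondConfig (Fin n)⦄, (⋃ s ∈ S, openEdgeCluster ω s) ⊆ (⋃ s ∈ S, openEdgeCluster ω' s) → ω ∈ A → ω' ∈ A) :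
    IsLowerSet Aᶜ :=
  (isUpperSet_of_clusterMono S hA).compl

/-- **G⁺ from the edge KEY form.**  If for every `n`, all terminal sets `S, T`, all cluster-monotone `A` (w.r.t. `C_S`) and `B` (w.r.t. `C_T`),
every weight function `w` and every pair `e`, the KEY form of `E₃({S ↮ T}, Aᶜ, Bᶜ)` along `e` is nonnegative whenever `E₃ ≥ 0` under both
`w[e↦0]` and `w[e↦1]`, then `ClusterBHK3Pos` holds (edge induction `EdgeInduction.sahiE3_nonneg_of_edgeKey`). [this work] -/
theorem clusterBHK3Pos_of_key
    (hK : ∀ (n : ℕ) (S T : Set (Fin n)) (A B : Set (BondConfig (Fin n))),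
      (∀ ⦃ω ω' : BondConfig (Fin n)⦄, (⋃ s ∈ S, openEdgeCluster ω s) ⊆ (⋃ s ∈ S, openEdgeCluster ω' s) → ω ∈ A → ω' ∈ A) →
      (∀ ⦃ω ω' : BondConfig (Fin n)⦄, (⋃ t ∈ T, openEdgeCluster ω t) ⊆ (⋃ t ∈ T, openEdgeCluster ω' t) → ω ∈ B → ω' ∈ B) →
      ∀ (w : Sym2 (Fin n) → unitInterval) (e : Sym2 (Fin n)),
        0 ≤ sahiE3 (prodBernoulli (Function.update w e 0))
              {ω : BondConfig (Fin n) | ∀ s ∈ S, ∀ t ∈ T, ¬ (openGraph ω).Reachable s t} Aᶜ Bᶜ →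
        0 ≤ sahiE3 (prodBernoulli (Function.update w e 1))
              {ω : BondConfig (Fin n) | ∀ s ∈ S, ∀ t ∈ T, ¬ (openGraph ω).Reachable s t} Aᶜ Bᶜ →
        0 ≤ key (prodBernoulli (Function.update w e 0)) (prodBernoulli (Function.update w e 1))
              {ω : BondConfig (Fin n) | ∀ s ∈ S, ∀ t ∈ T, ¬ (openGraph ω).Reachable s t} Aᶜ Bᶜ) :
    ClusterBHK3Pos := by
  intro n w S T A B hA hB
  exact EdgeInduction.sahiE3_nonneg_of_edgeKey _ Aᶜ Bᶜ (ClusterMarkovE3.isLowerSet_sepEv S T)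
    (isLowerSet_compl_of_clusterMono S hA) (isLowerSet_compl_of_clusterMono T hB) (hK n S T A B hA hB) w

/-- **G-KEY ⟹ G⁺** between the named conjectures of `…ClusterBHK3Defs`: `ClusterBHK3Key → ClusterBHK3Pos`. [this work] -/
theorem clusterBHK3Pos_of_clusterBHK3Key (hK : ClusterBHK3Key) : ClusterBHK3Pos :=
  clusterBHK3Pos_of_key hK

end Summit.CriticalPhenomena.PercolationContinuityZ3.Theorems.FrontierDecRows
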